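import Literature.Analysis.OperatorTheory.Enflo2023.StepRealisationRun
import HarnessLib

/-!
# Enflo (2023), v2 pp.16–20: the SCALE of the side-condition functional — the uniform-modulus residual
`IndepRun₂` is vacuous; the intrinsically normalised residual `IndepRunκ`

P. H. Enflo, *On the invariant subspace problem in Hilbert spaces*, arXiv:2305.15442v2 (2023) — a CLAIMED result
under adjudication; nothing in this file asserts the manuscript's theorem.

`StepRealisation` / `StepRealisationRun` reduce the run-restricted residual of Part B to the text's first-order
independence (34) in the two-fold form `IndepBr₂ W x₀ c ι σ` (side condition (46) and decrease (b′) targeted, the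
side functional `Δ ↦ −⟪κ(c), (Δ+Δ†)ℓ⟫` normalised by `‖ℓ‖·‖c‖`, `κ(c) := W†[ ]⁻¹c`), asked with ONE modulus `σ`
along the run (`IndepRun₂`, packaged as `PartBResidualIndep₂ → Referee.ISP_separable`).

## 1. That residual is VACUOUS (§§A–C)
At a pivot the side-condition vector is the moved vector itself, `c = x₀ − z = Wℓ` (`x₀_sub_bz`), and
`κ(Wℓ) = W†[ ]⁻¹Wℓ` has `‖κ(Wℓ)‖ ≤ ‖ℓ‖ = (εθ)^{1/2}` (`norm_bκ_self_le`) — NOT `≍ ‖c‖ ≥ 0.3`.  So the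
`‖ℓ‖‖c‖`-normalised side functional has norm `≤ 2‖κ(c)‖/‖c‖ · ‖Δ‖`, and `IndepBr₂ … σ` (target `(1, 0)`) forces
`σ‖c‖ ≤ 2‖κ(c)‖` (`indepBr₂_le`), i.e. at a pivot `σ‖x₀ − z‖ ≤ 2(εθ)^{1/2}` (`indepBr₂_self_le`,
`indepAt₂_self_le`: `(0.3σ)² ≤ 4(εθ)`); for a side vector within angle `η` of `x₀ − z` still
`0.3(σ − η) ≤ 2(εθ)^{1/2}` (`indepAt₂_angle_le`).  Along the run `(εθ)_n = (1−β)ⁿ(εθ)₀ → 0` with every state its own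
pivot, so `IndepRun₂ T x₀ S ι σ β s₀` with the start margin forces `(εθ)₀ = 0` (`indepRun₂_etheta_eq_zero`,
`partB₂_witness_etheta_eq_zero`): the second disjunct of `PartBResidualIndep₂` never does any work.  This is a
defect of OUR normalisation (gen 11), not a claim about the text: (34) compares `f f̄` and `f ḡ` at their own scales.

## 2. The intrinsically normalised residual (§§D–F)
Normalising the side functional by its own scale `‖ℓ‖·‖κ(c)‖` (`Λfκ`, `Φκ`, `IndepBrκ`) the Graves step goes through
VERBATIM — the side remainder is `≤ 35 r ‖κ(c)‖‖ℓ‖‖Δ‖` (`side_remainderκ`, via `‖κ_N(c) − κ(c)‖ ≤ (100/27) r ‖κ(c)‖`,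
`norm_bκN_sub_le`), still inside the Lipschitz defect `250ρ` (`approximatesLinearOnκ`) — giving `exists_stepκ`,
`exists_state_stepκ`, `claimRun_of_indepRunκ`, `nis_of_indepRunκ` and the packaged residual
`PartBResidualIndepκ → Referee.ISP_separable` (`isp_of_partBResidualIndepκ`).  The old form implies the new one at the
same `σ` (`indepBrκ_of_indepBr₂`, `partBResidualIndepκ_of_indep₂`); conversely the new one at `σ` is the old one at
the state-dependent modulus `σ‖κ(c)‖/‖c‖ ≲ σ(εθ)^{1/2}` (`indepBr₂_of_indepBrκ`) — the text's `s(εθ)` of L541–L545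
read as `≍ (εθ)^{1/2}`, with a UNIFORM ratio `β` nonetheless.  The new form is NOT vacuous by the scale
argument; its necessary condition at a pivot is `σ‖ℓ‖ ≤ 2‖ℓ − μκ‖` for every `μ ∈ ℂ` (`indepBrκ_self_le`; uses
`π₀ = 2κ − ℓ`, `bπ_zero_eq`), i.e. `σ(εθ)^{1/2} ≤ 2·dist(ℓ, ℂκ)` with `κ = ℓ − (1 + W†W)⁻¹ℓ`: it fails exactly when
`ℓ` is an eigenvector of `W†W` — the text's "singular situation" (v2 p.14, Remark before (28)); with `μ = 1` it reads
`σ‖f‖ ≤ 2‖g‖` in the letters of (35)–(36), i.e. `Σ|b_j|² ≥ (σ/2)²(εθ)` along the run (`indepBrκ_self_le_g`).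

What is NOT a theorem here: `IndepRunκ` for any operator without invariant subspaces (it is (34) with one modulus
along the whole run, v2 p.16 "for some s > 0" and p.19–20 "we can assume that for all n …"); see `pub-enflo/GAP.md`
§"Formaliser 2, generation 12".
-/

noncomputable section

open scoped InnerProductSpace ComplexConjugate NNReal
open ContinuousLinearMap RCLike Metric Set

namespace Literature.Analysis.OperatorTheory.Enflo2023

namespace StepRealisation

open MCStep

variable {E H : Type*} [NormedAddCommGroup E] [InnerProductSpace ℂ E] [CompleteSpace E]
  [NormedAddCommGroup H] [InnerProductSpace ℂ H] [CompleteSpace H]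

/-! ### A. Pivot algebra: `x₀ − z = Wℓ`, `‖κ(x₀ − z)‖ ≤ ‖ℓ‖`, `π₀ = 2κ(x₀ − z) − ℓ`, `‖κ_N − κ‖ ≤ (100/27)r‖κ‖` -/

section PivotAlgebra

variable (W : E →L[ℂ] H) (x₀ : H)

/-- At the bracket point the moved vector is `x₀ − z = Wℓ` ((15)). [cite: Enflo2023, v2 (15), p.6] -/
lemma x₀_sub_bz : x₀ - bz W x₀ = W (ba W x₀) := by
  calc x₀ - bz W x₀ = x₀ - (x₀ - W (adjoint W (bz W x₀))) := by rw [(isBracket_bz W x₀).sub_eq]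
    _ = W (ba W x₀) := by rw [sub_sub_cancel]; rfl

/-- `‖κ(x₀ − z)‖ = ‖W†[ ]⁻¹Wℓ‖ ≤ ‖ℓ‖ = (εθ)^{1/2}` — the side-condition functional at a pivot lives at scale
`(εθ)^{1/2}·‖ℓ‖`, not `‖x₀ − z‖·‖ℓ‖`. [folklore] -/
lemma norm_bκ_self_le : ‖bκ W (x₀ - bz W x₀)‖ ≤ ‖ba W x₀‖ := by
  rw [x₀_sub_bz, bκ]
  exact (bounds_base W (ba W x₀) x₀).2.1

/-- `κ(x₀ − z) = ℓ − W†[ ]⁻¹z`. [folklore] -/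
lemma bκ_self_eq : bκ W (x₀ - bz W x₀) = ba W x₀ - adjoint W (brInv W (bz W x₀)) := by
  rw [bκ, map_sub, map_sub, ba, bz]

/-- `π₀ = 2κ(x₀ − z) − ℓ`: at a pivot the decrease functional is `2·Re(side) + Re⟪ℓ, (Δ+Δ†)ℓ⟫`. [cite: Enflo2023, v2 (31), (36)–(37), p.16] -/
lemma bπ_zero_eq : bπ W x₀ 0 0 = (2 : ℂ) • bκ W (x₀ - bz W x₀) - ba W x₀ := by
  have h0 : bπ W x₀ 0 0 = ba W x₀ - (2 : ℂ) • adjoint W (brInv W (bz W x₀)) := by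
    rw [bπ, perturb_zero, zN_zero, map_sub, map_smul, map_sub, map_smul]; rfl
  have h1 : adjoint W (brInv W (bz W x₀)) = ba W x₀ - bκ W (x₀ - bz W x₀) := by
    rw [bκ_self_eq, sub_sub_cancel]
  rw [h0, h1, two_smul, two_smul]
  abel

/-- `κ` is additive and homogeneous in the side-condition vector. [folklore] -/
lemma bκ_sub (c c' : H) : bκ W (c - c') = bκ W c - bκ W c' := by
  simp only [bκ, map_sub]

/-- `κ` is homogeneous in the side-condition vector. [folklore] -/
lemma bκ_smul (μ : ℂ) (c : H) : bκ W (μ • c) = μ • bκ W c := by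
  simp only [bκ, map_smul]

/-- For a side-condition vector `c` within angle `η` of `x₀ − z` (the form of `MCStep.Claim`):
`‖x₀ − z‖·‖κ(c)‖ ≤ ‖c‖·(‖ℓ‖ + (η/2)‖x₀ − z‖)`. [folklore] -/
lemma norm_bκ_le_of_angle (c : H) {η : ℝ}
    (hang : ‖((‖x₀ - bz W x₀‖ : ℝ) : ℂ) • c - ((‖c‖ : ℝ) : ℂ) • (x₀ - bz W x₀)‖ ≤
      η * (‖c‖ * ‖x₀ - bz W x₀‖)) :
    ‖x₀ - bz W x₀‖ * ‖bκ W c‖ ≤ ‖c‖ * ‖ba W x₀‖ + η / 2 * (‖c‖ * ‖x₀ - bz W x₀‖) := by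
  set u := x₀ - bz W x₀ with hu
  set d := ((‖u‖ : ℝ) : ℂ) • c - ((‖c‖ : ℝ) : ℂ) • u with hd
  have h1 : ((‖u‖ : ℝ) : ℂ) • bκ W c = ((‖c‖ : ℝ) : ℂ) • bκ W u + bκ W d := by
    rw [hd, bκ_sub W (((‖u‖ : ℝ) : ℂ) • c) (((‖c‖ : ℝ) : ℂ) • u), bκ_smul, bκ_smul]
    abel
  have h2 : ‖bκ W d‖ ≤ 1 / 2 * ‖d‖ := norm_bκ_le W d
  have h3 : ‖bκ W u‖ ≤ ‖ba W x₀‖ := norm_bκ_self_le W x₀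
  calc ‖u‖ * ‖bκ W c‖ = ‖((‖u‖ : ℝ) : ℂ) • bκ W c‖ := by
        rw [norm_smul, Complex.norm_real, Real.norm_of_nonneg (norm_nonneg _)]
    _ ≤ ‖((‖c‖ : ℝ) : ℂ) • bκ W u‖ + ‖bκ W d‖ := by rw [h1]; exact norm_add_le _ _
    _ ≤ ‖c‖ * ‖ba W x₀‖ + 1 / 2 * (η * (‖c‖ * ‖u‖)) := by
        rw [norm_smul, Complex.norm_real, Real.norm_of_nonneg (norm_nonneg _)]
        exact add_le_add (mul_le_mul_of_nonneg_left h3 (norm_nonneg _)) (h2.trans (by linarith))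
    _ = ‖c‖ * ‖ba W x₀‖ + η / 2 * (‖c‖ * ‖u‖) := by ring

/-- `‖κ_N(c) − κ(c)‖ ≤ (100/27)·r·‖κ(c)‖` for `‖N‖ ≤ r ≤ 1/10` — the perturbation of `κ` is proportional to `κ`
itself (sharper than `norm_bκ_sub_le`'s `2r‖c‖`, and what makes the `‖κ‖`-normalisation uniform). [folklore] -/
lemma norm_bκN_sub_le {N : E →L[ℂ] E} {r : ℝ} (hN : ‖N‖ ≤ r) (hr : r ≤ 1 / 10) (c : H) :
    ‖adjoint W (brInv (W ∘L (1 + N)) c) - bκ W c‖ ≤ 100 / 27 * r * ‖bκ W c‖ := by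
  have hr0 : 0 ≤ r := (norm_nonneg _).trans hN
  have hQ := norm_Q_le_three hN hr
  have h1 : adjoint W (brInv (W ∘L (1 + N)) c) - bκ W c =
      -adjoint W (brInv (W ∘L (1 + N)) (W (Q N (bκ W c)))) := by
    rw [bκ, ← map_sub, brInv_perturb_sub, map_neg]
  have hb : ‖Q N (bκ W c)‖ ≤ 3 * r * ‖bκ W c‖ := (le_opNorm _ _).trans (by gcongr)
  have h := (bounds_pert W (hN.trans hr) (Q N (bκ W c)) c).2.1
  rw [h1, norm_neg]
  linarith

/-- (E2κ) Side-condition remainder at the intrinsic scale: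
`‖⟪c, z₂ − z₁⟫ + ⟪κ, Lin(N₂−N₁)ℓ⟫‖ ≤ 35 r ‖κ‖‖ℓ‖‖N₂ − N₁‖`. [cite: Enflo2023, v2 (37), (46), p.16–19] -/
lemma side_remainderκ (c : H) {N₁ N₂ : E →L[ℂ] E} {r : ℝ} (h₁ : ‖N₁‖ ≤ r) (h₂ : ‖N₂‖ ≤ r)
    (hr : r ≤ 1 / 10) :
    ‖⟪c, zN W x₀ N₂ - zN W x₀ N₁⟫_ℂ + ⟪bκ W c, Lin (N₂ - N₁) (ba W x₀)⟫_ℂ‖ ≤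
      35 * r * ‖bκ W c‖ * ‖ba W x₀‖ * ‖N₂ - N₁‖ := by
  have hr0 : 0 ≤ r := (norm_nonneg _).trans h₁
  have hA := norm_nonneg (ba W x₀)
  have hG₁ := (norm_D_le W x₀ h₁ hr).2
  have hw₁ := norm_adjoint_zN_le W x₀ h₁ hr
  have hΔQ := norm_Q_sub_le_three (h₁.trans hr) (h₂.trans hr)
  have hQL := norm_Q_sub_sub_Lin_le_two h₁ h₂
  have hL := norm_Lin_le (N₂ - N₁)
  have hκ₂ := norm_bκN_sub_le W h₂ hr c
  have hq : ‖adjoint W (zN W x₀ N₁) - ba W x₀‖ ≤ 4 * r * ‖ba W x₀‖ := by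
    rw [ba, ← map_sub]; exact hG₁
  have key := norm_inner_bilin_sub_le (bκ W c) (adjoint W (brInv (W ∘L (1 + N₂)) c))
    (ba W x₀) (adjoint W (zN W x₀ N₁)) (Lin (N₂ - N₁)) (Q N₂ - Q N₁)
  have hnn : 0 ≤ r * ‖bκ W c‖ * ‖ba W x₀‖ * ‖N₂ - N₁‖ := by positivity
  rw [side_two_point, neg_add_eq_sub, norm_sub_rev]
  calc _ ≤ _ := key
    _ ≤ 100 / 27 * r * ‖bκ W c‖ * (3 * ‖N₂ - N₁‖) * (2 * ‖ba W x₀‖) +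
        ‖bκ W c‖ * (2 * r * ‖N₂ - N₁‖) * (2 * ‖ba W x₀‖) +
        ‖bκ W c‖ * (2 * ‖N₂ - N₁‖) * (4 * r * ‖ba W x₀‖) :=
      add_le_add_three
        (norm_mul3_le hκ₂ hΔQ hw₁)
        (norm_mul3_le le_rfl hQL hw₁)
        (norm_mul3_le le_rfl hL hq)
    _ ≤ 35 * r * ‖bκ W c‖ * ‖ba W x₀‖ * ‖N₂ - N₁‖ := by linarith

end PivotAlgebra

/-! ### B. The scale obstruction for `IndepBr₂` -/

section GravesScale

variable {P : Type*} [NormedAddCommGroup P] [NormedSpace ℝ P]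
variable (W : E →L[ℂ] H) (x₀ c : H) (ι : P →+ (E →L[ℂ] E))

omit [NormedSpace ℝ P] in
/-- The side-condition functional is bounded by its own scale: `‖⟪κ, Lin(Δ)ℓ⟫‖ ≤ 2‖κ‖‖ℓ‖‖Δ‖`. [folklore] -/
lemma norm_side_inner_le (Δ : E →L[ℂ] E) :
    ‖⟪bκ W c, Lin Δ (ba W x₀)⟫_ℂ‖ ≤ 2 * ‖bκ W c‖ * ‖ba W x₀‖ * ‖Δ‖ := by
  have hL := norm_Lin_le Δ
  calc _ ≤ ‖bκ W c‖ * ‖Lin Δ (ba W x₀)‖ := norm_inner_le_norm _ _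
    _ ≤ ‖bκ W c‖ * (2 * ‖Δ‖ * ‖ba W x₀‖) := by
        gcongr
        exact (le_opNorm _ _).trans (mul_le_mul_of_nonneg_right hL (norm_nonneg _))
    _ = _ := by ring

omit [NormedSpace ℝ P] in
/-- **THE SCALE OBSTRUCTION.** `IndepBr₂ W x₀ c ι σ` (side functional normalised by `‖ℓ‖‖c‖`) forces
`σ‖c‖ ≤ 2‖κ(c)‖`: the target `(1, 0)` of norm `1` must be the normalised side effect of a direction of norm `≤ 1/σ`,
whose side effect is at most `2‖κ(c)‖‖ℓ‖/σ`. [folklore] -/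
theorem indepBr₂_le {σ : ℝ} (hσ : 0 < σ) (hι1 : ∀ p, ‖ι p‖ ≤ ‖p‖) (h : IndepBr₂ W x₀ c ι σ) :
    σ * ‖c‖ ≤ 2 * ‖bκ W c‖ := by
  obtain ⟨p, hp, hpn⟩ := h ((1 : ℂ), (0 : ℝ))
  have ht : ‖((1 : ℂ), (0 : ℝ))‖ = 1 := by simp [Prod.norm_def]
  rw [ht] at hpn
  have h1 : -⟪bκ W c, Lin (ι p) (ba W x₀)⟫_ℂ / ((‖ba W x₀‖ * ‖c‖ : ℝ) : ℂ) = 1 := by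
    have := congrArg Prod.fst hp
    simpa only [Λf] using this
  by_cases hm0 : ‖ba W x₀‖ * ‖c‖ = 0
  · rw [hm0, Complex.ofReal_zero, div_zero] at h1
    exact absurd h1 zero_ne_one
  · have hm1 : 0 < ‖ba W x₀‖ * ‖c‖ := lt_of_le_of_ne (by positivity) (Ne.symm hm0)
    have hA0 : 0 < ‖ba W x₀‖ := by
      rcases (norm_nonneg (ba W x₀)).eq_or_lt with h0 | h0
      · exact absurd (by rw [← h0, zero_mul]) hm0
      · exact h0
    have h2 : ‖⟪bκ W c, Lin (ι p) (ba W x₀)⟫_ℂ‖ = ‖ba W x₀‖ * ‖c‖ := by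
      have := congrArg (fun w : ℂ => ‖w‖) h1
      simp only [norm_div, norm_neg, Complex.norm_real, Real.norm_of_nonneg hm1.le, norm_one] at this
      exact (div_eq_one_iff_eq hm0).1 this
    have h3 := norm_side_inner_le W x₀ c (ι p)
    rw [h2] at h3
    have h5 : ‖ba W x₀‖ * ‖c‖ ≤ ‖ba W x₀‖ * (2 * ‖bκ W c‖ / σ) := by
      calc ‖ba W x₀‖ * ‖c‖ ≤ 2 * ‖bκ W c‖ * ‖ba W x₀‖ * ‖ι p‖ := h3
        _ ≤ 2 * ‖bκ W c‖ * ‖ba W x₀‖ * (1 / σ) := by gcongr; exact (hι1 p).trans hpn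
        _ = ‖ba W x₀‖ * (2 * ‖bκ W c‖ / σ) := by ring
    have h6 : ‖c‖ ≤ 2 * ‖bκ W c‖ / σ := le_of_mul_le_mul_left h5 hA0
    rw [le_div_iff₀ hσ] at h6
    linarith

omit [NormedSpace ℝ P] in
/-- At a pivot (`c = x₀ − z`): `IndepBr₂ … σ` forces `σ‖x₀ − z‖ ≤ 2‖ℓ‖ = 2(εθ)^{1/2}`. [folklore] -/
theorem indepBr₂_self_le {σ : ℝ} (hσ : 0 < σ) (hι1 : ∀ p, ‖ι p‖ ≤ ‖p‖)
    (h : IndepBr₂ W x₀ (x₀ - bz W x₀) ι σ) : σ * ‖x₀ - bz W x₀‖ ≤ 2 * ‖ba W x₀‖ :=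
  (indepBr₂_le W x₀ (x₀ - bz W x₀) ι hσ hι1 h).trans (by linarith [norm_bκ_self_le W x₀])

omit [NormedSpace ℝ P] in
/-- For a side-condition vector within angle `η` of `x₀ − z`: `IndepBr₂ … σ` forces
`σ‖c‖‖x₀ − z‖ ≤ ‖c‖(2‖ℓ‖ + η‖x₀ − z‖)`. [folklore] -/
theorem indepBr₂_angle_le {σ η : ℝ} (hσ : 0 < σ) (hι1 : ∀ p, ‖ι p‖ ≤ ‖p‖)
    (hang : ‖((‖x₀ - bz W x₀‖ : ℝ) : ℂ) • c - ((‖c‖ : ℝ) : ℂ) • (x₀ - bz W x₀)‖ ≤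
      η * (‖c‖ * ‖x₀ - bz W x₀‖))
    (h : IndepBr₂ W x₀ c ι σ) :
    σ * ‖c‖ * ‖x₀ - bz W x₀‖ ≤ ‖c‖ * (2 * ‖ba W x₀‖ + η * ‖x₀ - bz W x₀‖) := by
  have h1 := indepBr₂_le W x₀ c ι hσ hι1 h
  have h2 := norm_bκ_le_of_angle W x₀ c hang
  have h3 := mul_le_mul_of_nonneg_right h1 (norm_nonneg (x₀ - bz W x₀))
  calc σ * ‖c‖ * ‖x₀ - bz W x₀‖ ≤ 2 * ‖bκ W c‖ * ‖x₀ - bz W x₀‖ := h3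
    _ = 2 * (‖x₀ - bz W x₀‖ * ‖bκ W c‖) := by ring
    _ ≤ 2 * (‖c‖ * ‖ba W x₀‖ + η / 2 * (‖c‖ * ‖x₀ - bz W x₀‖)) := by linarith
    _ = ‖c‖ * (2 * ‖ba W x₀‖ + η * ‖x₀ - bz W x₀‖) := by ring

/-! ### D. The intrinsic normalisation: side functional scaled by `‖ℓ‖·‖κ(c)‖` -/

/-- The two targeted step functionals of a direction `p` — side condition `⟪c, z' − z⟫` ((46)) and decrease
`(εθ)' − (εθ)` ((b′)) — normalised by their INTRINSIC scales `‖ℓ‖‖κ(c)‖` and `‖ℓ‖² = (εθ)`.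
[cite: Enflo2023, v2 (36)–(37), (46), p.16–19] -/
def Φκ (p : P) : ℂ × ℝ :=
  (⟪c, zN W x₀ (ι p) - bz W x₀⟫_ℂ / ((‖ba W x₀‖ * ‖bκ W c‖ : ℝ) : ℂ),
    (eth x₀ (zN W x₀ (ι p)) - eth x₀ (bz W x₀)) / ‖ba W x₀‖ ^ 2)

/-- Their first-order parts, same normalisation. [cite: Enflo2023, v2 (36)–(37), p.16] -/
def Λfκ (Δ : E →L[ℂ] E) : ℂ × ℝ :=
  (-⟪bκ W c, Lin Δ (ba W x₀)⟫_ℂ / ((‖ba W x₀‖ * ‖bκ W c‖ : ℝ) : ℂ),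
    -(⟪bπ W x₀ 0 0, Lin Δ (ba W x₀)⟫_ℂ).re / ‖ba W x₀‖ ^ 2)

omit [NormedSpace ℝ P] in
/-- no step, no change. [folklore] -/
@[simp] lemma Φκ_zero : Φκ W x₀ c ι 0 = 0 := by
  simp [Φκ]

omit [NormedSpace ℝ P] in
/-- `Λfκ` is additive. [folklore] -/
lemma Λfκ_add (Δ₁ Δ₂ : E →L[ℂ] E) : Λfκ W x₀ c (Δ₁ + Δ₂) = Λfκ W x₀ c Δ₁ + Λfκ W x₀ c Δ₂ := by
  simp only [Λfκ, Lin_add, add_apply, inner_add_right, Complex.add_re, Prod.mk_add_mk]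
  refine Prod.ext ?_ ?_ <;> simp only <;> ring

omit [NormedSpace ℝ P] in
/-- `Λfκ` is real-homogeneous. [folklore] -/
lemma Λfκ_smul (t : ℝ) (Δ : E →L[ℂ] E) : Λfκ W x₀ c ((t : ℂ) • Δ) = t • Λfκ W x₀ c Δ := by
  simp only [Λfκ, Lin_smul, smul_apply, inner_smul_right, Complex.re_ofReal_mul, Prod.smul_mk, smul_eq_mul,
    Complex.real_smul]
  refine Prod.ext ?_ ?_ <;> simp only <;> ring

omit [NormedSpace ℝ P] in
/-- `‖Λfκ(Δ)‖ ≤ 10‖Δ‖` (the side component has norm `≤ 2‖Δ‖` BY CONSTRUCTION of the scale). [folklore] -/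
lemma norm_Λfκ_le (Δ : E →L[ℂ] E) : ‖Λfκ W x₀ c Δ‖ ≤ 10 * ‖Δ‖ := by
  have hA := norm_nonneg (ba W x₀)
  have hL := norm_Lin_le Δ
  have hLa : ‖Lin Δ (ba W x₀)‖ ≤ 2 * ‖Δ‖ * ‖ba W x₀‖ := (le_opNorm _ _).trans (by gcongr)
  have h2 : ‖-⟪bκ W c, Lin Δ (ba W x₀)⟫_ℂ‖ ≤ 2 * ‖Δ‖ * (‖ba W x₀‖ * ‖bκ W c‖) := by
    rw [norm_neg]
    calc _ ≤ 2 * ‖bκ W c‖ * ‖ba W x₀‖ * ‖Δ‖ := norm_side_inner_le W x₀ c Δ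
      _ = 2 * ‖Δ‖ * (‖ba W x₀‖ * ‖bκ W c‖) := by ring
  have h3 : |(-(⟪bπ W x₀ 0 0, Lin Δ (ba W x₀)⟫_ℂ).re)| ≤ 10 * ‖Δ‖ * ‖ba W x₀‖ ^ 2 := by
    rw [abs_neg]
    calc _ ≤ ‖⟪bπ W x₀ 0 0, Lin Δ (ba W x₀)⟫_ℂ‖ := Complex.abs_re_le_norm _
      _ ≤ ‖bπ W x₀ 0 0‖ * ‖Lin Δ (ba W x₀)‖ := norm_inner_le_norm _ _
      _ ≤ 5 * ‖ba W x₀‖ * (2 * ‖Δ‖ * ‖ba W x₀‖) :=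
          mul_le_mul (norm_bπ_zero_le W x₀) hLa (norm_nonneg _) (by positivity)
      _ = 10 * ‖Δ‖ * ‖ba W x₀‖ ^ 2 := by ring
  rw [Λfκ, Prod.norm_def, Real.norm_eq_abs]
  refine max_le ?_ ?_
  · exact (norm_div_ofReal_le (by positivity) (by positivity) h2).trans (by linarith [norm_nonneg Δ])
  · exact abs_div_sq_le (by positivity) h3

variable {W x₀ c ι}

/-- `Λκ`: the first-order parts as a continuous ℝ-linear operator on the parameter space (`‖Λκ‖ ≤ 10`).
[cite: Enflo2023, v2 (36)–(37), p.16] -/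
def Λκ (hιs : ∀ (t : ℝ) (p : P), ι (t • p) = (t : ℂ) • ι p) (hι1 : ∀ p, ‖ι p‖ ≤ ‖p‖) :
    P →L[ℝ] ℂ × ℝ :=
  LinearMap.mkContinuous
    { toFun := fun p => Λfκ W x₀ c (ι p)
      map_add' := fun p q => by simp only [map_add, Λfκ_add]
      map_smul' := fun t p => by simp only [hιs, Λfκ_smul, RingHom.id_apply] }
    10 (fun p => (norm_Λfκ_le W x₀ c (ι p)).trans (by linarith [hι1 p]))

/-- `Λκ p = Λfκ (ι p)`. [folklore] -/
@[simp] lemma Λκ_apply (hιs : ∀ (t : ℝ) (p : P), ι (t • p) = (t : ℂ) • ι p) (hι1 : ∀ p, ‖ι p‖ ≤ ‖p‖)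
    (p : P) : Λκ (W := W) (x₀ := x₀) (c := c) hιs hι1 p = Λfκ W x₀ c (ι p) := rfl

/-- THE REMAINDER ESTIMATE at the intrinsic scale: on the ball of radius `ρ ≤ 1/10` the normalised pair is
`250ρ`-approximately linear with derivative `Λκ`, uniformly in `(εθ)` AND in `c` (side remainder `35ρ`, decrease
remainder `224ρ`). [cite: Enflo2023, v2 (36)–(38), p.16–17] -/
theorem approximatesLinearOnκ (hιs : ∀ (t : ℝ) (p : P), ι (t • p) = (t : ℂ) • ι p)
    (hι1 : ∀ p, ‖ι p‖ ≤ ‖p‖) {ρ : ℝ} (hρ0 : 0 ≤ ρ) (hρ : ρ ≤ 1 / 10) :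
    ApproximatesLinearOn (Φκ W x₀ c ι) (Λκ (W := W) (x₀ := x₀) (c := c) hιs hι1) (closedBall 0 ρ)
      (250 * ρ).toNNReal := by
  intro p hp q hq
  have h₂ : ‖ι p‖ ≤ ρ := (hι1 p).trans (mem_closedBall_zero_iff.1 hp)
  have h₁ : ‖ι q‖ ≤ ρ := (hι1 q).trans (mem_closedBall_zero_iff.1 hq)
  have hA := norm_nonneg (ba W x₀)
  have hκ := norm_nonneg (bκ W c)
  have E2 := side_remainderκ W x₀ c h₁ h₂ hρ
  have E3 := eth_remainder W x₀ h₁ h₂ hρ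
  have hΔ : ‖ι p - ι q‖ ≤ ‖p - q‖ := by rw [← map_sub]; exact hι1 _
  have hm : 0 ≤ ρ * ‖p - q‖ := by positivity
  have hval : Φκ W x₀ c ι p - Φκ W x₀ c ι q - Λκ (W := W) (x₀ := x₀) (c := c) hιs hι1 (p - q) =
      ((⟪c, zN W x₀ (ι p) - zN W x₀ (ι q)⟫_ℂ + ⟪bκ W c, Lin (ι p - ι q) (ba W x₀)⟫_ℂ) /
          ((‖ba W x₀‖ * ‖bκ W c‖ : ℝ) : ℂ),
        (eth x₀ (zN W x₀ (ι p)) - eth x₀ (zN W x₀ (ι q)) + (⟪bπ W x₀ 0 0, Lin (ι p - ι q) (ba W x₀)⟫_ℂ).re) /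
          ‖ba W x₀‖ ^ 2) := by
    rw [Λκ_apply, map_sub]
    simp only [Φκ, Λfκ, Prod.mk_sub_mk, inner_sub_right]
    refine Prod.ext ?_ ?_ <;> simp only <;> ring
  rw [hval, Prod.norm_def, Real.norm_eq_abs, Real.coe_toNNReal _ (by positivity)]
  refine max_le ?_ ?_
  · refine norm_div_ofReal_le (by positivity) (by positivity) (E2.trans ?_)
    calc 35 * ρ * ‖bκ W c‖ * ‖ba W x₀‖ * ‖ι p - ι q‖ ≤ 35 * ρ * ‖bκ W c‖ * ‖ba W x₀‖ * ‖p - q‖ := by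
          gcongr
      _ ≤ 250 * ρ * ‖p - q‖ * (‖ba W x₀‖ * ‖bκ W c‖) := by
          nlinarith [mul_nonneg hm (mul_nonneg hA hκ)]
  · refine abs_div_sq_le (by positivity) (E3.trans ?_)
    calc 224 * ρ * ‖ba W x₀‖ ^ 2 * ‖ι p - ι q‖ ≤ 224 * ρ * ‖ba W x₀‖ ^ 2 * ‖p - q‖ := by gcongr
      _ ≤ 250 * ρ * ‖p - q‖ * ‖ba W x₀‖ ^ 2 := by nlinarith [mul_nonneg hm (sq_nonneg ‖ba W x₀‖)]

variable (W x₀ c ι)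

/-- (34) IN THE INTRINSICALLY NORMALISED TWO-FOLD FORM: every target pair `t` (side effect in units of
`‖ℓ‖‖κ(c)‖`, decrease in units of `(εθ)`) is the first-order effect of an admissible direction `p` with
`‖p‖ ≤ ‖t‖/σ`.  Over the commutant of the shift this is the `(εθ)`-linear independence of `f f̄`, `f ḡ` of
(28″)–(29″)/(34)–(36), each compared AT ITS OWN SCALE.  A HYPOTHESIS, never a theorem. [cite: Enflo2023, v2 (34)–(38), p.16–17] -/
def IndepBrκ (σ : ℝ) : Prop := ∀ t : ℂ × ℝ, ∃ p : P, Λfκ W x₀ c (ι p) = t ∧ ‖p‖ ≤ ‖t‖ / σ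

variable {W x₀ c ι}

omit [NormedSpace ℝ P] in
/-- Non-degeneracy: `IndepBrκ` needs `ℓ ≠ 0` and `κ(c) ≠ 0` (else the side functional vanishes). [folklore] -/
lemma IndepBrκ.ne_zero {σ : ℝ} (h : IndepBrκ W x₀ c ι σ) : ba W x₀ ≠ 0 ∧ bκ W c ≠ 0 := by
  obtain ⟨p, hp, -⟩ := h ((1 : ℂ), (0 : ℝ))
  have h1 : -⟪bκ W c, Lin (ι p) (ba W x₀)⟫_ℂ / ((‖ba W x₀‖ * ‖bκ W c‖ : ℝ) : ℂ) = 1 := by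
    have := congrArg Prod.fst hp
    simpa only [Λfκ] using this
  constructor
  · intro h0
    rw [h0, map_zero, inner_zero_right, neg_zero, zero_div] at h1
    exact zero_ne_one h1
  · intro h0
    rw [h0, inner_zero_left, neg_zero, zero_div] at h1
    exact zero_ne_one h1

variable (W x₀ c ι)

/-- GRAVES STEP at the intrinsic scale: under `IndepBrκ σ` every target pair of size `≤ σ²/1000` is realised
EXACTLY (remainders included) by a direction of size `≤ 2‖t‖/σ`. [cite: Enflo2023, v2 (36)–(40), p.16–17] -/
theorem exists_preimageκ [CompleteSpace P] (hιs : ∀ (t : ℝ) (p : P), ι (t • p) = (t : ℂ) • ι p)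
    (hι1 : ∀ p, ‖ι p‖ ≤ ‖p‖) {σ : ℝ} (hσ : 0 < σ) (hσ1 : σ ≤ 1) (hind : IndepBrκ W x₀ c ι σ)
    (t : ℂ × ℝ) (ht : ‖t‖ ≤ σ ^ 2 / 1000) :
    ∃ p : P, ‖p‖ ≤ 2 * ‖t‖ / σ ∧ Φκ W x₀ c ι p = t := by
  have ht0 := norm_nonneg t
  have hσ2 : σ ^ 2 ≤ σ := by nlinarith
  have hρ0 : 0 ≤ 2 * ‖t‖ / σ := by positivity
  have hρ : 2 * ‖t‖ / σ ≤ 1 / 10 := by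
    rw [div_le_iff₀ hσ]; linarith
  have hA := approximatesLinearOnκ (W := W) (x₀ := x₀) (c := c) hιs hι1 hρ0 hρ
  let RI : (Λκ (W := W) (x₀ := x₀) (c := c) hιs hι1).NonlinearRightInverse :=
    { toFun := fun t => Classical.choose (hind t)
      nnnorm := (σ⁻¹).toNNReal
      bound' := fun t => by
        have := (Classical.choose_spec (hind t)).2
        rw [Real.coe_toNNReal _ (inv_nonneg.2 hσ.le), ← div_eq_inv_mul]
        exact this
      right_inv' := fun t => by
        rw [Λκ_apply]
        exact (Classical.choose_spec (hind t)).1 }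
  have hs := hA.surjOn_closedBall_of_nonlinearRightInverse RI hρ0 subset_rfl
  have hrad : ‖t‖ ≤ (((RI.nnnorm : ℝ))⁻¹ - ((250 * (2 * ‖t‖ / σ)).toNNReal : ℝ)) * (2 * ‖t‖ / σ) := by
    rw [show (RI.nnnorm : ℝ) = σ⁻¹ from Real.coe_toNNReal _ (inv_nonneg.2 hσ.le), inv_inv,
      Real.coe_toNNReal _ (by positivity)]
    have h1 : 250 * (2 * ‖t‖ / σ) ≤ σ / 2 := by
      rw [show 250 * (2 * ‖t‖ / σ) = 500 * ‖t‖ / σ by ring, div_le_iff₀ hσ]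
      nlinarith
    have h2 : (σ / 2) * (2 * ‖t‖ / σ) ≤ (σ - 250 * (2 * ‖t‖ / σ)) * (2 * ‖t‖ / σ) :=
      mul_le_mul_of_nonneg_right (by linarith) hρ0
    have h3 : (σ / 2) * (2 * ‖t‖ / σ) = ‖t‖ := by field_simp
    linarith
  have hmem : t ∈ closedBall (Φκ W x₀ c ι 0)
      ((((RI.nnnorm : ℝ))⁻¹ - ((250 * (2 * ‖t‖ / σ)).toNNReal : ℝ)) * (2 * ‖t‖ / σ)) := by
    simpa only [mem_closedBall, dist_eq_norm, Φκ_zero, sub_zero] using hrad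
  obtain ⟨p, hp, hpt⟩ := hs hmem
  exact ⟨p, mem_closedBall_zero_iff.1 hp, hpt⟩

/-- THE CONSTRAINED STEP WITH REMAINDERS at the intrinsic scale (bracket level): under `IndepBrκ σ`, for
`0 ≤ β ≤ σ²/1000` there is an admissible direction `p`, `‖p‖ ≤ 2β/σ`, whose EXACT new MC vector has
`(εθ)' = (1 − β)(εθ)` ((b′)) and `⟪c, z' − z⟫ = 0` ((46)) EXACTLY, the drift bound (45)
`|Re⟪x₀, z' − z⟫| ≤ (22/σ)β(εθ)`, and `|‖z'‖² − ‖z‖²| ≤ (22/σ + 1)β(εθ)`. [cite: Enflo2023, v2 (39)–(46), p.17–19] -/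
theorem exists_stepκ [CompleteSpace P] (hιs : ∀ (t : ℝ) (p : P), ι (t • p) = (t : ℂ) • ι p)
    (hι1 : ∀ p, ‖ι p‖ ≤ ‖p‖) {σ β : ℝ} (hσ : 0 < σ) (hσ1 : σ ≤ 1) (hβ0 : 0 ≤ β)
    (hβ : β ≤ σ ^ 2 / 1000) (hind : IndepBrκ W x₀ c ι σ) :
    ∃ p : P, ‖p‖ ≤ 2 * β / σ ∧
      eth x₀ (zN W x₀ (ι p)) = (1 - β) * eth x₀ (bz W x₀) ∧
      ⟪c, zN W x₀ (ι p) - bz W x₀⟫_ℂ = 0 ∧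
      |(⟪x₀, zN W x₀ (ι p) - bz W x₀⟫_ℂ).re| ≤ 22 / σ * β * eth x₀ (bz W x₀) ∧
      |‖zN W x₀ (ι p)‖ ^ 2 - ‖bz W x₀‖ ^ 2| ≤ (22 / σ + 1) * β * eth x₀ (bz W x₀) := by
  obtain ⟨hA, hκ⟩ := hind.ne_zero
  have hσ2 : σ ^ 2 ≤ σ := by nlinarith
  have ht : ‖((0, -β) : ℂ × ℝ)‖ = β := by
    simp only [Prod.norm_def, norm_zero, Real.norm_eq_abs, abs_neg, abs_of_nonneg hβ0]
    exact max_eq_right hβ0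
  obtain ⟨p, hp, hΦ⟩ := exists_preimageκ W x₀ c ι hιs hι1 hσ hσ1 hind (0, -β) (by rw [ht]; exact hβ)
  rw [ht] at hp
  have hA0 : 0 < ‖ba W x₀‖ := norm_pos_iff.2 hA
  have hκ0 : 0 < ‖bκ W c‖ := norm_pos_iff.2 hκ
  have hA2 : (0 : ℝ) < ‖ba W x₀‖ ^ 2 := by positivity
  -- the drift is bounded by smallness (first component of the three-fold remainder estimate):
  -- ‖Φ p‖ ≤ ‖Φ p − Λ p‖ + ‖Λ p‖ ≤ (250ρ + 10)‖p‖ ≤ 11‖p‖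
  have hρ0 : 0 ≤ 2 * β / σ := by positivity
  have hρ : 2 * β / σ ≤ 1 / 10 := by
    rw [div_le_iff₀ hσ]; linarith
  have hsmall : 250 * (2 * β / σ) ≤ 1 := by
    rw [show 250 * (2 * β / σ) = 500 * β / σ by ring, div_le_iff₀ hσ]; linarith
  have happ := approximatesLinearOn (W := W) (x₀ := x₀) (c := c) hιs hι1 hρ0 hρ
    p (mem_closedBall_zero_iff.2 hp) 0 (mem_closedBall_zero_iff.2 (by rw [norm_zero]; exact hρ0))
  rw [Φ_zero, sub_zero, sub_zero, Real.coe_toNNReal _ (by positivity)] at happ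
  have hΛ : ‖Λ (W := W) (x₀ := x₀) (c := c) hιs hι1 p‖ ≤ 10 * ‖p‖ := by
    rw [Λ_apply]; exact (norm_Λf_le W x₀ c (ι p)).trans (by linarith [hι1 p])
  have hΦn : ‖Φ W x₀ c ι p‖ ≤ 11 * ‖p‖ := by
    have hp0 := norm_nonneg p
    calc ‖Φ W x₀ c ι p‖
        = ‖(Φ W x₀ c ι p - Λ (W := W) (x₀ := x₀) (c := c) hιs hι1 p) +
            Λ (W := W) (x₀ := x₀) (c := c) hιs hι1 p‖ := by rw [sub_add_cancel]
      _ ≤ ‖Φ W x₀ c ι p - Λ (W := W) (x₀ := x₀) (c := c) hιs hι1 p‖ +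
            ‖Λ (W := W) (x₀ := x₀) (c := c) hιs hι1 p‖ := norm_add_le _ _
      _ ≤ 250 * (2 * β / σ) * ‖p‖ + 10 * ‖p‖ := add_le_add happ hΛ
      _ ≤ 11 * ‖p‖ := by nlinarith [mul_le_mul_of_nonneg_right hsmall hp0]
  have hdrift : |(⟪x₀, zN W x₀ (ι p) - bz W x₀⟫_ℂ).re| ≤ 22 / σ * β * ‖ba W x₀‖ ^ 2 := by
    have h1 : |(Φ W x₀ c ι p).1| ≤ 11 * ‖p‖ := by
      have := _root_.norm_fst_le (Φ W x₀ c ι p)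
      rw [Real.norm_eq_abs] at this
      exact this.trans hΦn
    have h1' : |(⟪x₀, zN W x₀ (ι p) - bz W x₀⟫_ℂ).re / ‖ba W x₀‖ ^ 2| ≤ 11 * ‖p‖ := by
      simpa only [Φ] using h1
    rw [abs_div, abs_of_pos hA2, div_le_iff₀ hA2] at h1'
    calc _ ≤ 11 * ‖p‖ * ‖ba W x₀‖ ^ 2 := h1'
      _ ≤ 11 * (2 * β / σ) * ‖ba W x₀‖ ^ 2 := by gcongr
      _ = 22 / σ * β * ‖ba W x₀‖ ^ 2 := by ring
  simp only [Φκ, Prod.mk.injEq] at hΦ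
  obtain ⟨h2, h3⟩ := hΦ
  rw [div_eq_iff hA2.ne'] at h3
  have he := eth_bz W x₀
  rw [he] at h3 ⊢
  have hside : ⟪c, zN W x₀ (ι p) - bz W x₀⟫_ℂ = 0 := by
    rcases div_eq_zero_iff.1 h2 with h | h
    · exact h
    · exfalso
      have hc : ‖ba W x₀‖ * ‖bκ W c‖ = 0 := by exact_mod_cast h
      exact (mul_pos hA0 hκ0).ne' hc
  have hz' := norm_sq_eq_of_isBracket (isBracket_zN W x₀ (ι p))
  have hz := norm_sq_eq_of_isBracket (isBracket_bz W x₀)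
  rw [he] at hz
  have hdr : (⟪zN W x₀ (ι p), x₀⟫_ℂ).re - (⟪bz W x₀, x₀⟫_ℂ).re =
      (⟪x₀, zN W x₀ (ι p) - bz W x₀⟫_ℂ).re := by
    rw [← Complex.sub_re, ← inner_sub_left]
    have := inner_re_symm (𝕜 := ℂ) (zN W x₀ (ι p) - bz W x₀) x₀
    simpa only [RCLike.re_to_complex] using this
  have hrad : ‖zN W x₀ (ι p)‖ ^ 2 - ‖bz W x₀‖ ^ 2 =
      (⟪x₀, zN W x₀ (ι p) - bz W x₀⟫_ℂ).re + β * ‖ba W x₀‖ ^ 2 := by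
    rw [hz', hz, ← hdr]; linarith
  refine ⟨p, hp, by linarith, hside, hdrift, ?_⟩
  rw [hrad]
  calc |(⟪x₀, zN W x₀ (ι p) - bz W x₀⟫_ℂ).re + β * ‖ba W x₀‖ ^ 2|
      ≤ |(⟪x₀, zN W x₀ (ι p) - bz W x₀⟫_ℂ).re| + |β * ‖ba W x₀‖ ^ 2| := abs_add_le _ _
    _ ≤ 22 / σ * β * ‖ba W x₀‖ ^ 2 + β * ‖ba W x₀‖ ^ 2 := by
        rw [abs_of_nonneg (by positivity : 0 ≤ β * ‖ba W x₀‖ ^ 2)]; exact add_le_add hdrift le_rfl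
    _ = (22 / σ + 1) * β * ‖ba W x₀‖ ^ 2 := by ring

omit [NormedSpace ℝ P] in
/-- The `‖ℓ‖‖c‖`-normalised form IMPLIES the intrinsic one at the same modulus (`‖κ(c)‖ ≤ ‖c‖/2 ≤ ‖c‖`: the
intrinsic targets are smaller). [folklore] -/
theorem indepBrκ_of_indepBr₂ {σ : ℝ} (hσ : 0 < σ) (h : IndepBr₂ W x₀ c ι σ) : IndepBrκ W x₀ c ι σ := by
  obtain ⟨p₁, hp₁, -⟩ := h ((1 : ℂ), (0 : ℝ))
  have h1 : -⟪bκ W c, Lin (ι p₁) (ba W x₀)⟫_ℂ / ((‖ba W x₀‖ * ‖c‖ : ℝ) : ℂ) = 1 := by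
    have := congrArg Prod.fst hp₁
    simpa only [Λf] using this
  have hκ : bκ W c ≠ 0 := by
    intro h0; rw [h0, inner_zero_left, neg_zero, zero_div] at h1; exact zero_ne_one h1
  have hm : ‖ba W x₀‖ * ‖c‖ ≠ 0 := by
    intro h0; rw [h0, Complex.ofReal_zero, div_zero] at h1; exact zero_ne_one h1
  have hc : ‖c‖ ≠ 0 := fun h0 => hm (by rw [h0, mul_zero])
  have hκ0 : 0 < ‖bκ W c‖ := norm_pos_iff.2 hκ
  have hc0 : 0 < ‖c‖ := lt_of_le_of_ne (norm_nonneg _) (Ne.symm hc)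
  set μ : ℝ := ‖bκ W c‖ / ‖c‖ with hμ
  have hμ0 : 0 < μ := div_pos hκ0 hc0
  have hμ1 : μ ≤ 1 := by
    rw [hμ, div_le_one hc0]; linarith [norm_bκ_le W c, norm_nonneg c]
  have hμc : (μ : ℂ) ≠ 0 := by exact_mod_cast hμ0.ne'
  have hden : ((‖ba W x₀‖ * ‖bκ W c‖ : ℝ) : ℂ) = ((‖ba W x₀‖ * ‖c‖ : ℝ) : ℂ) * (μ : ℂ) := by
    rw [← Complex.ofReal_mul]
    congr 1
    rw [hμ]
    field_simp
  intro t
  obtain ⟨p, hp, hpn⟩ := h ((μ : ℂ) * t.1, t.2)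
  have hp1 := congrArg Prod.fst hp
  have hp2 := congrArg Prod.snd hp
  simp only [Λf] at hp1 hp2
  refine ⟨p, Prod.ext ?_ ?_, hpn.trans ?_⟩
  · show -⟪bκ W c, Lin (ι p) (ba W x₀)⟫_ℂ / ((‖ba W x₀‖ * ‖bκ W c‖ : ℝ) : ℂ) = t.1
    rw [hden, ← div_div, hp1, mul_comm, mul_div_assoc, div_self hμc, mul_one]
  · show -(⟪bπ W x₀ 0 0, Lin (ι p) (ba W x₀)⟫_ℂ).re / ‖ba W x₀‖ ^ 2 = t.2
    exact hp2
  · have hle : ‖(((μ : ℂ) * t.1, t.2) : ℂ × ℝ)‖ ≤ ‖t‖ := by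
      rw [Prod.norm_def, Prod.norm_def]
      refine max_le_max ?_ le_rfl
      rw [norm_mul, Complex.norm_real, Real.norm_of_nonneg hμ0.le]
      exact mul_le_of_le_one_left (norm_nonneg _) hμ1
    exact div_le_div_of_nonneg_right hle hσ.le

omit [NormedSpace ℝ P] in
/-- Conversely, the intrinsic form at modulus `σ` gives the `‖ℓ‖‖c‖`-normalised form at the STATE-DEPENDENT
modulus `σ‖κ(c)‖/‖c‖` — at a pivot `≤ σ(εθ)^{1/2}/‖x₀ − z‖ ≤ σ(εθ)^{1/2}/0.3` (`norm_bκ_self_le`), the largest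
modulus the scale obstruction `indepBr₂_le` allows up to the factor `‖κ(c)‖/‖ℓ‖ ≤ 1`.  So the re-typed residual is
the gen-11 one read with the text's `(εθ)`-dependent modulus `s(εθ) ≍ (εθ)^{1/2}` (v2 p.16, L541–L545) — for which
the Graves bookkeeping still closes with a UNIFORM ratio `β = σ²/1000` because the side remainder is itself
`∝ ‖κ(c)‖` (`side_remainderκ`). [folklore] -/
theorem indepBr₂_of_indepBrκ {σ : ℝ} (hσ : 0 < σ) (hc : c ≠ 0) (h : IndepBrκ W x₀ c ι σ) :
    IndepBr₂ W x₀ c ι (σ * (‖bκ W c‖ / ‖c‖)) := by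
  obtain ⟨-, hκ⟩ := h.ne_zero
  have hκ0 : 0 < ‖bκ W c‖ := norm_pos_iff.2 hκ
  have hc0 : 0 < ‖c‖ := norm_pos_iff.2 hc
  set μ : ℝ := ‖bκ W c‖ / ‖c‖ with hμ
  have hμ0 : 0 < μ := div_pos hκ0 hc0
  have hμ1 : μ ≤ 1 := by
    rw [hμ, div_le_one hc0]; linarith [norm_bκ_le W c, norm_nonneg c]
  have hμc : (μ : ℂ) ≠ 0 := by exact_mod_cast hμ0.ne'
  have hden : ((‖ba W x₀‖ * ‖c‖ : ℝ) : ℂ) = ((‖ba W x₀‖ * ‖bκ W c‖ : ℝ) : ℂ) / (μ : ℂ) := by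
    rw [eq_div_iff hμc, ← Complex.ofReal_mul]
    congr 1
    rw [hμ]
    field_simp
  intro t
  obtain ⟨p, hp, hpn⟩ := h (((μ : ℂ))⁻¹ * t.1, t.2)
  have hp1 := congrArg Prod.fst hp
  have hp2 := congrArg Prod.snd hp
  simp only [Λfκ] at hp1 hp2
  refine ⟨p, Prod.ext ?_ ?_, hpn.trans ?_⟩
  · show -⟪bκ W c, Lin (ι p) (ba W x₀)⟫_ℂ / ((‖ba W x₀‖ * ‖c‖ : ℝ) : ℂ) = t.1
    rw [hden, div_div_eq_mul_div, mul_div_right_comm, hp1, mul_comm, ← mul_assoc, mul_inv_cancel₀ hμc,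
      one_mul]
  · show -(⟪bπ W x₀ 0 0, Lin (ι p) (ba W x₀)⟫_ℂ).re / ‖ba W x₀‖ ^ 2 = t.2
    exact hp2
  · have hle : ‖((((μ : ℂ))⁻¹ * t.1, t.2) : ℂ × ℝ)‖ ≤ ‖t‖ / μ := by
      rw [Prod.norm_def, max_le_iff]
      constructor
      · rw [norm_mul, norm_inv, Complex.norm_real, Real.norm_of_nonneg hμ0.le, inv_mul_eq_div]
        exact div_le_div_of_nonneg_right (_root_.norm_fst_le t) hμ0.le
      · exact (_root_.norm_snd_le t).trans (le_div_self (norm_nonneg _) hμ0 hμ1)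
    calc ‖((((μ : ℂ))⁻¹ * t.1, t.2) : ℂ × ℝ)‖ / σ ≤ ‖t‖ / μ / σ := div_le_div_of_nonneg_right hle hσ.le
      _ = ‖t‖ / (σ * (‖bκ W c‖ / ‖c‖)) := by rw [div_div, mul_comm, hμ]

omit [NormedSpace ℝ P] in
/-- **NECESSARY CONDITION for the intrinsic form at a pivot** (`c = x₀ − z`): the target `(0, −1)` (the actual
step: side condition exact, unit decrease) needs a direction with `⟪κ, Lin(Δ)ℓ⟫ = 0` and `Re⟪ℓ, Lin(Δ)ℓ⟫ = −(εθ)`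
(`π₀ = 2κ − ℓ`), so `σ‖ℓ‖ ≤ 2‖ℓ − μκ‖` for every `μ ∈ ℂ` — `σ(εθ)^{1/2} ≤ 2·dist(ℓ, ℂκ)`, `κ = ℓ − (1 + W†W)⁻¹ℓ`.
It fails for every `σ > 0` exactly when `ℓ` is an eigenvector of `W†W` (v2 p.14, the "singular situation").
[cite: Enflo2023, v2 p.14 Remark; (36)–(37) p.16] -/
theorem indepBrκ_self_le {σ : ℝ} (hσ : 0 < σ) (hι1 : ∀ p, ‖ι p‖ ≤ ‖p‖)
    (h : IndepBrκ W x₀ (x₀ - bz W x₀) ι σ) (μ : ℂ) :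
    σ * ‖ba W x₀‖ ≤ 2 * ‖ba W x₀ - μ • bκ W (x₀ - bz W x₀)‖ := by
  obtain ⟨hA, hκ⟩ := h.ne_zero
  have hA0 : 0 < ‖ba W x₀‖ := norm_pos_iff.2 hA
  have hκ0 : 0 < ‖bκ W (x₀ - bz W x₀)‖ := norm_pos_iff.2 hκ
  have hA2 : (0 : ℝ) < ‖ba W x₀‖ ^ 2 := by positivity
  obtain ⟨p, hp, hpn⟩ := h ((0 : ℂ), (-1 : ℝ))
  have ht : ‖((0 : ℂ), (-1 : ℝ))‖ = 1 := by simp [Prod.norm_def]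
  rw [ht] at hpn
  have hp1 : -⟪bκ W (x₀ - bz W x₀), Lin (ι p) (ba W x₀)⟫_ℂ /
      ((‖ba W x₀‖ * ‖bκ W (x₀ - bz W x₀)‖ : ℝ) : ℂ) = 0 := by
    have := congrArg Prod.fst hp
    simpa only [Λfκ] using this
  have hp2 : -(⟪bπ W x₀ 0 0, Lin (ι p) (ba W x₀)⟫_ℂ).re / ‖ba W x₀‖ ^ 2 = -1 := by
    have := congrArg Prod.snd hp
    simpa only [Λfκ] using this
  have hside : ⟪bκ W (x₀ - bz W x₀), Lin (ι p) (ba W x₀)⟫_ℂ = 0 := by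
    rcases div_eq_zero_iff.1 hp1 with h0 | h0
    · exact neg_eq_zero.1 h0
    · exfalso
      have : ‖ba W x₀‖ * ‖bκ W (x₀ - bz W x₀)‖ = 0 := by exact_mod_cast h0
      exact (mul_pos hA0 hκ0).ne' this
  have hdec : (⟪ba W x₀, Lin (ι p) (ba W x₀)⟫_ℂ).re = -‖ba W x₀‖ ^ 2 := by
    rw [div_eq_iff hA2.ne', bπ_zero_eq, inner_sub_left, inner_smul_left, hside, mul_zero, zero_sub,
      Complex.neg_re, neg_neg, neg_one_mul] at hp2
    exact hp2
  have hinner : ⟪ba W x₀ - μ • bκ W (x₀ - bz W x₀), Lin (ι p) (ba W x₀)⟫_ℂ =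
      ⟪ba W x₀, Lin (ι p) (ba W x₀)⟫_ℂ := by
    rw [inner_sub_left, inner_smul_left, hside, mul_zero, sub_zero]
  have hL := norm_Lin_le (ι p)
  have hv : ‖Lin (ι p) (ba W x₀)‖ ≤ 2 * ‖ι p‖ * ‖ba W x₀‖ := (le_opNorm _ _).trans (by gcongr)
  have h1 : ‖ba W x₀‖ ^ 2 ≤ ‖ba W x₀ - μ • bκ W (x₀ - bz W x₀)‖ * (2 * (1 / σ) * ‖ba W x₀‖) := by
    calc ‖ba W x₀‖ ^ 2 = |(⟪ba W x₀ - μ • bκ W (x₀ - bz W x₀), Lin (ι p) (ba W x₀)⟫_ℂ).re| := by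
          rw [hinner, hdec, abs_neg, abs_of_nonneg hA2.le]
      _ ≤ ‖⟪ba W x₀ - μ • bκ W (x₀ - bz W x₀), Lin (ι p) (ba W x₀)⟫_ℂ‖ := Complex.abs_re_le_norm _
      _ ≤ ‖ba W x₀ - μ • bκ W (x₀ - bz W x₀)‖ * ‖Lin (ι p) (ba W x₀)‖ := norm_inner_le_norm _ _
      _ ≤ ‖ba W x₀ - μ • bκ W (x₀ - bz W x₀)‖ * (2 * ‖ι p‖ * ‖ba W x₀‖) := by gcongr
      _ ≤ ‖ba W x₀ - μ • bκ W (x₀ - bz W x₀)‖ * (2 * (1 / σ) * ‖ba W x₀‖) := by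
          gcongr; exact (hι1 p).trans hpn
  have h2 : ‖ba W x₀‖ * ‖ba W x₀‖ ≤ ‖ba W x₀‖ * (2 * ‖ba W x₀ - μ • bκ W (x₀ - bz W x₀)‖ / σ) := by
    calc ‖ba W x₀‖ * ‖ba W x₀‖ = ‖ba W x₀‖ ^ 2 := (sq _).symm
      _ ≤ _ := h1
      _ = _ := by ring
  have h3 := le_of_mul_le_mul_left h2 hA0
  rw [le_div_iff₀ hσ] at h3
  linarith

omit [NormedSpace ℝ P] in
/-- In the text's letters ((35)–(36): `ℓ = W†z ↔ f ↔ (a_j)`, `W†[ ]⁻¹z ↔ g ↔ (b_j)`, v2 p.16; `(εθ) = Σ|a_j|²`): the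
intrinsic form with modulus `σ` at a pivot needs `σ‖f‖ ≤ 2‖g‖`, i.e. `Σ_j |b_j|² ≥ (σ/2)²·Σ_j |a_j|² = (σ/2)²(εθ)` at
every state of the run (`μ = 1` in `indepBrκ_self_le`: `ℓ − κ(x₀ − z) = W†[ ]⁻¹z`).  Compare the Remark p.14
(L444–L447: in the "singular situation" `b_m ≈ 0` for `m ≥ 1`) and the sharpened (25) (`|b_{j₃}|, |b_{j₄}| > (εθ)³⁰`,
a polynomially small lower bound where a uniform one is consumed). [cite: Enflo2023, v2 (35)–(36) p.16; Remark p.14] -/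
theorem indepBrκ_self_le_g {σ : ℝ} (hσ : 0 < σ) (hι1 : ∀ p, ‖ι p‖ ≤ ‖p‖)
    (h : IndepBrκ W x₀ (x₀ - bz W x₀) ι σ) :
    σ * ‖ba W x₀‖ ≤ 2 * ‖adjoint W (brInv W (bz W x₀))‖ := by
  have h1 := indepBrκ_self_le W x₀ ι hσ hι1 h 1
  rwa [one_smul, bκ_self_eq, sub_sub_cancel] at h1

end GravesScale

/-! ### C/E. At the level of MC states -/

section StateLevelScale

variable {T : H →L[ℂ] H} {x₀ : H} {S : E →L[ℂ] E}
variable {P : Type*} [NormedAddCommGroup P] [NormedSpace ℝ P]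

omit [CompleteSpace E] [CompleteSpace H] in
/-- The moved vector has norm `≥ 0.3` at a true MC state (`‖x₀‖ = 1`, `ε ≤ 0.7`). [cite: Enflo2023, v2 p.2, p.17] -/
lemma norm_x₀_sub_v_ge (hx₀ : ‖x₀‖ = 1) (s : State T x₀ S) : (0.3 : ℝ) ≤ ‖x₀ - s.v‖ := by
  have := norm_sub_norm_le x₀ s.v
  rw [hx₀, s.norm_v hx₀] at this
  linarith [s.hε.2]

omit [NormedSpace ℝ P] in
/-- **The scale obstruction at a state**: `IndepAt₂ ι σ s (x₀ − v_s)` with `(εθ)_s > 0` forces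
`(0.3σ)² ≤ 4(εθ)_s`. [folklore] -/
theorem indepAt₂_self_le (hx₀ : ‖x₀‖ = 1) {ι : P →+ (E →L[ℂ] E)} (hι1 : ∀ p, ‖ι p‖ ≤ ‖p‖) {σ : ℝ}
    (hσ : 0 < σ) (s : State T x₀ S) (he : 0 < s.etheta) (h : IndepAt₂ ι σ s (x₀ - s.v)) :
    (0.3 * σ) ^ 2 ≤ 4 * s.etheta := by
  have hbr : IsBracket (Wn s) x₀ s.v := isBracket_Wn hx₀ s he
  have hvz : s.v = bz (Wn s) x₀ := hbr.unique (isBracket_bz (Wn s) x₀)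
  have hes : s.etheta = ‖ba (Wn s) x₀‖ ^ 2 := by rw [etheta_eq_eth, hvz, eth_bz]
  have h' : IndepBr₂ (Wn s) x₀ (x₀ - bz (Wn s) x₀) ι σ := by rw [← hvz]; exact h
  have h1 := indepBr₂_self_le (Wn s) x₀ ι hσ hι1 h'
  rw [← hvz] at h1
  have h2 := norm_x₀_sub_v_ge hx₀ s
  have h0 : (0 : ℝ) ≤ 0.3 * σ := by positivity
  have h3 : 0.3 * σ ≤ 2 * ‖ba (Wn s) x₀‖ := by nlinarith
  rw [hes]
  calc (0.3 * σ) ^ 2 ≤ (2 * ‖ba (Wn s) x₀‖) ^ 2 := pow_le_pow_left₀ h0 h3 2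
    _ = 4 * ‖ba (Wn s) x₀‖ ^ 2 := by ring

omit [NormedSpace ℝ P] in
/-- … and for a side-condition vector `c ≠ 0` within angle `η` of `x₀ − v_s` (the form of `MCStep.Claim` /
`ClaimRun` at a pivot): `0.3(σ − η) ≤ 2(εθ)_s^{1/2}`.  So no realisation of the run-restricted residual through
`IndepAt₂` with a uniform `σ` and an angle modulus `G(E) → 0` survives `(εθ) → 0`. [folklore] -/
theorem indepAt₂_angle_le (hx₀ : ‖x₀‖ = 1) {ι : P →+ (E →L[ℂ] E)} (hι1 : ∀ p, ‖ι p‖ ≤ ‖p‖) {σ η : ℝ}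
    (hσ : 0 < σ) (s : State T x₀ S) (he : 0 < s.etheta) {c : H} (hc : c ≠ 0)
    (hang : ‖((‖x₀ - s.v‖ : ℝ) : ℂ) • c - ((‖c‖ : ℝ) : ℂ) • (x₀ - s.v)‖ ≤ η * (‖c‖ * ‖x₀ - s.v‖))
    (h : IndepAt₂ ι σ s c) : 0.3 * (σ - η) ≤ 2 * Real.sqrt s.etheta := by
  have hbr : IsBracket (Wn s) x₀ s.v := isBracket_Wn hx₀ s he
  have hvz : s.v = bz (Wn s) x₀ := hbr.unique (isBracket_bz (Wn s) x₀)
  have hes : Real.sqrt s.etheta = ‖ba (Wn s) x₀‖ := by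
    rw [etheta_eq_eth, hvz, eth_bz, Real.sqrt_sq (norm_nonneg _)]
  rw [hvz] at hang
  have h1 := indepBr₂_angle_le (Wn s) x₀ c ι hσ hι1 hang h
  rw [← hvz] at h1
  have h2 := norm_x₀_sub_v_ge hx₀ s
  have hc0 : 0 < ‖c‖ := norm_pos_iff.2 hc
  -- divide by ‖c‖: σ‖u‖ ≤ 2A + η‖u‖, i.e. (σ − η)‖u‖ ≤ 2A
  have h3 : ‖c‖ * ((σ - η) * ‖x₀ - s.v‖) ≤ ‖c‖ * (2 * ‖ba (Wn s) x₀‖) := by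
    have : σ * ‖c‖ * ‖x₀ - s.v‖ = ‖c‖ * (σ * ‖x₀ - s.v‖) := by ring
    nlinarith [h1]
  have h4 : (σ - η) * ‖x₀ - s.v‖ ≤ 2 * ‖ba (Wn s) x₀‖ := le_of_mul_le_mul_left h3 hc0
  rw [hes]
  rcases le_or_gt 0 (σ - η) with hpos | hneg
  · nlinarith [mul_le_mul_of_nonneg_left h2 hpos]
  · nlinarith [norm_nonneg (ba (Wn s) x₀)]

/-- THE STATE-LEVEL HYPOTHESIS at the intrinsic scale. [cite: Enflo2023, v2 (34), (36)–(38), p.16–17] -/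
def IndepAtκ (ι : P →+ (E →L[ℂ] E)) (σ : ℝ) (s : State T x₀ S) (c : H) : Prop := IndepBrκ (Wn s) x₀ c ι σ

omit [NormedSpace ℝ P] in
/-- old form ⟹ intrinsic form, same `σ`. [folklore] -/
theorem indepAtκ_of_indepAt₂ {ι : P →+ (E →L[ℂ] E)} {σ : ℝ} (hσ : 0 < σ) {s : State T x₀ S} {c : H}
    (h : IndepAt₂ ι σ s c) : IndepAtκ ι σ s c :=
  indepBrκ_of_indepBr₂ (Wn s) x₀ c ι hσ h

/-- THE MC STEP REALISED, WITH REMAINDERS — INTRINSIC FORM (same conclusions as `exists_state_step₂`).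
[cite: Enflo2023, v2 (34)–(46), p.16–19] -/
theorem exists_state_stepκ [CompleteSpace P] {ι : P →+ (E →L[ℂ] E)}
    (hιs : ∀ (t : ℝ) (p : P), ι (t • p) = (t : ℂ) • ι p) (hι1 : ∀ p, ‖ι p‖ ≤ ‖p‖)
    (hιS : ∀ p, ι p ∘L S = S ∘L ι p) (hx₀ : ‖x₀‖ = 1) (s : State T x₀ S) (he : 0 < s.etheta)
    {σ β : ℝ} (hσ : 0 < σ) (hσ1 : σ ≤ 1) (hβ0 : 0 ≤ β) (hβ : β ≤ σ ^ 2 / 1000) (c : H)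
    (hind : IndepAtκ ι σ s c) (hlo : (0.09 : ℝ) + (22 / σ + 1) * β * s.etheta ≤ s.ε ^ 2)
    (hhi : s.ε ^ 2 + (22 / σ + 1) * β * s.etheta ≤ 0.49) :
    ∃ s' : State T x₀ S, s'.etheta = (1 - β) * s.etheta ∧ ⟪c, s'.v - s.v⟫_ℂ = 0 ∧
      |(⟪x₀, s'.v - s.v⟫_ℂ).re| ≤ 22 / σ * β * s.etheta ∧
      |s'.ε ^ 2 - s.ε ^ 2| ≤ (22 / σ + 1) * β * s.etheta ∧
      ∃ p : P, ‖p‖ ≤ 2 * β / σ ∧ s'.V = Wn s ∘L (1 + ι p) := by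
  have hbr : IsBracket (Wn s) x₀ s.v := isBracket_Wn hx₀ s he
  have hvz : s.v = bz (Wn s) x₀ := hbr.unique (isBracket_bz (Wn s) x₀)
  have hes : s.etheta = eth x₀ (bz (Wn s) x₀) := by rw [etheta_eq_eth, hvz]
  obtain ⟨p, hp, h1, h2, h3, h4⟩ := exists_stepκ (Wn s) x₀ c ι hιs hι1 hσ hσ1 hβ0 hβ hind
  have hbr' : IsBracket (Wn s ∘L (1 + ι p)) x₀ (zN (Wn s) x₀ (ι p)) := isBracket_zN (Wn s) x₀ (ι p)
  have hVS' : ∀ b, (Wn s ∘L (1 + ι p)) (S b) = T ((Wn s ∘L (1 + ι p)) b) := by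
    intro b
    have hNS : ι p (S b) = S (ι p b) := by
      have := congrArg (fun A : E →L[ℂ] E => A b) (hιS p)
      simpa using this
    have h1' : (1 + ι p) (S b) = S ((1 + ι p) b) := by
      simp [hNS, map_add]
    rw [comp_apply, comp_apply, h1', Wn, smul_apply, smul_apply, s.hVS, map_smul]
  have hzε : ‖bz (Wn s) x₀‖ = s.ε := by rw [← hvz]; exact s.norm_v hx₀
  rw [hzε, ← hes] at h4
  rw [← hes] at h3
  have hwin : (0.3 : ℝ) ≤ ‖zN (Wn s) x₀ (ι p)‖ ∧ ‖zN (Wn s) x₀ (ι p)‖ ≤ 0.7 := by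
    have hn := norm_nonneg (zN (Wn s) x₀ (ι p))
    have hab := abs_le.1 h4
    constructor <;> nlinarith [hab.1, hab.2, hlo, hhi, hn]
  have hmin' : IsMinimal (Wn s ∘L (1 + ι p)) x₀ ‖zN (Wn s) x₀ (ι p)‖
      (adjoint (Wn s ∘L (1 + ι p)) (zN (Wn s) x₀ (ι p))) := hbr'.isMinimal
  let s' : State T x₀ S := ⟨Wn s ∘L (1 + ι p), hVS', ‖zN (Wn s) x₀ (ι p)‖, hwin, _, hmin'⟩
  have hv' : s'.v = zN (Wn s) x₀ (ι p) := hbr'.sub_eq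
  have he' : s'.etheta = eth x₀ (zN (Wn s) x₀ (ι p)) := by rw [etheta_eq_eth, hv']
  refine ⟨s', ?_, ?_, ?_, h4, p, hp, rfl⟩
  · rw [he', hes, h1]
  · rw [hv', hvz, h2]
  · rw [hv', hvz]; exact h3

end StateLevelScale

/-! ### C/F. Along the run -/

section RunLevelScale

variable {P : Type*} [NormedAddCommGroup P] [NormedSpace ℝ P]

/-- **THE UNIFORM-MODULUS RESIDUAL `IndepRun₂` IS VACUOUS**: with the start margin and `0 < β ≤ σ²/1000`,
`IndepRun₂ T x₀ S ι σ β s₀` forces `(εθ)₀ = 0`.  Every reachable state is its own pivot (it lies in its own epoch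
invariant), so `IndepAt₂ ι σ s (x₀ − v_s)` holds along the run `s₀, s₁, …` built by `exists_state_step₂` itself,
where `(εθ)_{s_n} = (1−β)ⁿ(εθ)₀ → 0` — contradicting `(0.3σ)² ≤ 4(εθ)_{s_n}` (`indepAt₂_self_le`). [folklore] -/
theorem indepRun₂_etheta_eq_zero [CompleteSpace P] {T : H →L[ℂ] H} {x₀ : H} (hx₀ : ‖x₀‖ = 1)
    {S : E →L[ℂ] E} (hS : ‖S‖ ≤ 1) {ι : P →+ (E →L[ℂ] E)}
    (hιs : ∀ (t : ℝ) (p : P), ι (t • p) = (t : ℂ) • ι p) (hι1 : ∀ p, ‖ι p‖ ≤ ‖p‖)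
    (hιS : ∀ p, ι p ∘L S = S ∘L ι p) {σ β : ℝ} (hσ : 0 < σ) (hσ1 : σ ≤ 1) (hβ0 : 0 < β)
    (hβ : β ≤ σ ^ 2 / 1000) (s₀ : State T x₀ S)
    (hstart : (0.09 : ℝ) + (22 / σ + 1) * s₀.etheta ≤ s₀.ε ^ 2 ∧
      s₀.ε ^ 2 + (22 / σ + 1) * s₀.etheta ≤ 0.49)
    (h : IndepRun₂ T x₀ S ι σ β s₀) : s₀.etheta = 0 := by
  have hσ2 : σ ^ 2 ≤ σ := by nlinarith
  have hβ1 : β < 1 := by linarith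
  have hR0 : RadInv σ s₀ s₀ := by
    show |s₀.ε ^ 2 - s₀.ε ^ 2| ≤ (22 / σ + 1) * (s₀.etheta - s₀.etheta)
    rw [sub_self, abs_zero, sub_self, mul_zero]
  have hself : ∀ s : State T x₀ S, InvP (22 / σ) s (x₀ - s.v) s := by
    intro s
    refine ⟨le_rfl, ?_, ?_⟩
    · rw [sub_self, inner_zero_right]
    · rw [sub_self, inner_zero_right, map_zero, abs_zero, sub_self, mul_zero]
  -- the lower bound at every reachable state with (εθ) > 0
  have hlow : ∀ s : State T x₀ S, ReachN (22 / σ) β (RadInv σ s₀) s₀ s → 0 < s.etheta →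
      (0.3 * σ) ^ 2 ≤ 4 * s.etheta := fun s hs he =>
    indepAt₂_self_le hx₀ hι1 hσ s he (h s s hs hs (hself s) he)
  -- the run: reachable states with (εθ) = (1 − β)^n (εθ)₀
  set K : ℝ := 22 / σ + 1 with hK
  have hK0 : 0 ≤ K := by positivity
  have iter : ∀ n : ℕ, ∃ s : State T x₀ S, ReachN (22 / σ) β (RadInv σ s₀) s₀ s ∧
      s.etheta = (1 - β) ^ n * s₀.etheta := by
    intro n
    induction n with
    | zero => exact ⟨s₀, ReachN.start, by rw [pow_zero, one_mul]⟩
    | succ n ih =>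
      obtain ⟨s, hs, hes⟩ := ih
      rcases (s.etheta_nonneg hx₀ hS).eq_or_lt with he | he
      · refine ⟨s, hs, ?_⟩
        have he0 : s₀.etheta = 0 := by
          have h0 : (1 - β) ^ n * s₀.etheta = 0 := by rw [← hes, ← he]
          rcases mul_eq_zero.1 h0 with h0 | h0
          · exact absurd h0 (pow_ne_zero _ (by linarith))
          · exact h0
        rw [← he, he0, mul_zero]
      · have hRs : |s.ε ^ 2 - s₀.ε ^ 2| ≤ K * (s₀.etheta - s.etheta) := hs.inv hR0
        have hβe : K * β * s.etheta ≤ K * s.etheta := by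
          have h1 : β * s.etheta ≤ s.etheta := mul_le_of_le_one_left he.le hβ1.le
          have h2 := mul_le_mul_of_nonneg_left h1 hK0
          linarith [h2]
        have hab := abs_le.1 hRs
        have hlo : (0.09 : ℝ) + (22 / σ + 1) * β * s.etheta ≤ s.ε ^ 2 := by
          rw [← hK]; linarith [hab.1, hstart.1]
        have hhi : s.ε ^ 2 + (22 / σ + 1) * β * s.etheta ≤ 0.49 := by
          rw [← hK]; linarith [hab.2, hstart.2]
        obtain ⟨s', h1, -, h3, h4, -⟩ := exists_state_step₂ hιs hι1 hιS hx₀ s he hσ hσ1 hβ0.le hβ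
          (x₀ - s.v) (h s s hs hs (hself s) he) hlo hhi
        refine ⟨s', ReachN.step hs ?_ h1.le ?_, by rw [h1, hes, pow_succ]; ring⟩
        · show |s'.ε ^ 2 - s₀.ε ^ 2| ≤ (22 / σ + 1) * (s₀.etheta - s'.etheta)
          rw [← hK] at h4 ⊢
          calc |s'.ε ^ 2 - s₀.ε ^ 2| ≤ |s'.ε ^ 2 - s.ε ^ 2| + |s.ε ^ 2 - s₀.ε ^ 2| := abs_sub_le _ _ _
            _ ≤ K * β * s.etheta + K * (s₀.etheta - s.etheta) := add_le_add h4 hRs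
            _ = K * (s₀.etheta - s'.etheta) := by rw [h1]; ring
        · rw [RCLike.re_to_complex]; exact h3
  by_contra hne
  have he0 : 0 < s₀.etheta := lt_of_le_of_ne (s₀.etheta_nonneg hx₀ hS) (Ne.symm hne)
  obtain ⟨n, hn⟩ := exists_pow_lt_of_lt_one (show 0 < (0.3 * σ) ^ 2 / (4 * s₀.etheta) by positivity)
    (show 1 - β < 1 by linarith)
  obtain ⟨s, hs, hes⟩ := iter n
  have hes0 : 0 < s.etheta := by rw [hes]; exact mul_pos (pow_pos (by linarith) _) he0
  have h1 := hlow s hs hes0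
  rw [hes] at h1
  rw [lt_div_iff₀ (by positivity)] at hn
  linarith

/-- **The second disjunct of `PartBResidualIndep₂` never does any work**: its data force `(εθ)₀ = 0` (where a
non-trivial closed invariant subspace is immediate, v2 p.4 after (9)).  So `PartBResidualIndep₂` (gen 11) is NOT an
honest residual of Part B; the faithful re-typing is `PartBResidualIndepκ` below. [folklore] -/
theorem partB₂_witness_etheta_eq_zero {H : Type} [NormedAddCommGroup H] [InnerProductSpace ℂ H]
    [CompleteSpace H] (T : H →L[ℂ] H) (x₀ : H) (s₀ : State T x₀ Vy.S) (σ : ℝ) (hx₀ : ‖x₀‖ = 1)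
    (hσ : 0 < σ) (hσ1 : σ ≤ 1)
    (hstart : (0.09 : ℝ) + (22 / σ + 1) * s₀.etheta ≤ s₀.ε ^ 2 ∧
      s₀.ε ^ 2 + (22 / σ + 1) * s₀.etheta ≤ 0.49)
    (hrun : IndepRun₂ T x₀ Vy.S (ιS Vy.S) σ (σ ^ 2 / 1000) s₀) : s₀.etheta = 0 := by
  obtain ⟨hιs, hι1, hιS⟩ := ιS_props (Vy.S)
  exact indepRun₂_etheta_eq_zero hx₀ Vy.norm_S_le hιs hι1 hιS hσ hσ1 (by positivity) le_rfl s₀ hstart hrun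

/-- A true MC state with `(εθ) = 0` gives a non-trivial closed invariant subspace AT ONCE ((9) with `(εθ) = 0`: the
orbit of `x₀ − v = Vℓ'` is orthogonal to `v ≠ 0`; v2 p.4 after (9) "then `y₀` is non-cyclic"). [cite: Enflo2023, v2 (9), p.4] -/
theorem nis_of_etheta_eq_zero {T : H →L[ℂ] H} {x₀ : H} (hx₀ : ‖x₀‖ = 1) {S : E →L[ℂ] E} (hS : ‖S‖ ≤ 1)
    (s : State T x₀ S) (h0 : s.etheta = 0) : HasNontrivialClosedInvariantSubspace T := by
  have hv : s.v ≠ 0 := by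
    intro h
    have := s.norm_v hx₀
    rw [h, norm_zero] at this
    linarith [s.hε.1]
  refine hasNontrivialClosedInvariantSubspace_of_orbit_orthogonal T (x₀_sub_v_ne_zero hx₀ s) hv fun j => ?_
  have h := s.h9 hx₀ hS j
  rw [h0, norm_le_zero_iff] at h
  rw [← inner_conj_symm, h, map_zero]

/-- … so the second disjunct of `PartBResidualIndep₂` yields the invariant subspace through the `(εθ)₀ = 0` door
ALONE — the independence hypothesis is never exercised on a state with `(εθ) > 0`. [folklore] -/
theorem nis_of_partB₂_witness {H : Type} [NormedAddCommGroup H] [InnerProductSpace ℂ H]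
    [CompleteSpace H] (T : H →L[ℂ] H) (x₀ : H) (s₀ : State T x₀ Vy.S) (σ : ℝ) (hx₀ : ‖x₀‖ = 1)
    (hσ : 0 < σ) (hσ1 : σ ≤ 1)
    (hstart : (0.09 : ℝ) + (22 / σ + 1) * s₀.etheta ≤ s₀.ε ^ 2 ∧
      s₀.ε ^ 2 + (22 / σ + 1) * s₀.etheta ≤ 0.49)
    (hrun : IndepRun₂ T x₀ Vy.S (ιS Vy.S) σ (σ ^ 2 / 1000) s₀) : HasNontrivialClosedInvariantSubspace T :=
  nis_of_etheta_eq_zero hx₀ Vy.norm_S_le s₀ (partB₂_witness_etheta_eq_zero T x₀ s₀ σ hx₀ hσ hσ1 hstart hrun)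

/-- THE RUN-LEVEL HYPOTHESIS, INTRINSIC FORM — the honest residual this route now reaches: the two-fold first-order
independence (34) `IndepAtκ ι σ s c` (side functional at its own scale `‖ℓ‖‖κ(c)‖`) with ONE constant `σ`, at
every state `s` with `(εθ)_s > 0` reachable from `s₀` (drift constant `22/σ`, ratio `β`, radius invariant
`RadInv σ s₀`) that lies in the epoch invariant of a reachable pivot `P`, for `c = x₀ − v_P`.  Asserted in the text
("for some s > 0", p.16; "we can assume that for all n, y_n will be δ₂-linearly independent", p.19–20), never
derived. [cite: Enflo2023, v2 (34) p.16; p.19–20] -/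
def IndepRunκ (T : H →L[ℂ] H) (x₀ : H) (S : E →L[ℂ] E) (ι : P →+ (E →L[ℂ] E)) (σ β : ℝ)
    (s₀ : State T x₀ S) : Prop :=
  ∀ Pv s : State T x₀ S, ReachN (22 / σ) β (RadInv σ s₀) s₀ Pv → ReachN (22 / σ) β (RadInv σ s₀) s₀ s →
    InvP (22 / σ) Pv (x₀ - Pv.v) s → 0 < s.etheta → IndepAtκ ι σ s (x₀ - Pv.v)

omit [NormedSpace ℝ P] in
/-- old run hypothesis ⟹ intrinsic one. [folklore] -/
theorem indepRunκ_of_indepRun₂ {T : H →L[ℂ] H} {x₀ : H} {S : E →L[ℂ] E} {ι : P →+ (E →L[ℂ] E)}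
    {σ β : ℝ} (hσ : 0 < σ) {s₀ : State T x₀ S} (h : IndepRun₂ T x₀ S ι σ β s₀) :
    IndepRunκ T x₀ S ι σ β s₀ :=
  fun Pv s hP hs hinv he => indepAtκ_of_indepAt₂ hσ (h Pv s hP hs hinv he)

/-- **Run-level intrinsic independence ⟹ the run-restricted residual** (`C = 22/σ`, `G ≥ 0` arbitrary, radius
invariant), given the start margin `(22/σ + 1)(εθ)₀`. [cite: Enflo2023, v2 (32), (34)–(46), p.15–19; p.19–20] -/
theorem claimRun_of_indepRunκ [CompleteSpace P] {T : H →L[ℂ] H} {x₀ : H} (hx₀ : ‖x₀‖ = 1) {S : E →L[ℂ] E}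
    (hS : ‖S‖ ≤ 1) {ι : P →+ (E →L[ℂ] E)} (hιs : ∀ (t : ℝ) (p : P), ι (t • p) = (t : ℂ) • ι p)
    (hι1 : ∀ p, ‖ι p‖ ≤ ‖p‖) (hιS : ∀ p, ι p ∘L S = S ∘L ι p) {σ β : ℝ} (hσ : 0 < σ) (hσ1 : σ ≤ 1)
    (hβ0 : 0 ≤ β) (hβ : β ≤ σ ^ 2 / 1000) (G : ℝ → ℝ) (hG0 : ∀ x, 0 ≤ G x) (s₀ : State T x₀ S)
    (hstart : (0.09 : ℝ) + (22 / σ + 1) * s₀.etheta ≤ s₀.ε ^ 2 ∧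
      s₀.ε ^ 2 + (22 / σ + 1) * s₀.etheta ≤ 0.49)
    (h : IndepRunκ T x₀ S ι σ β s₀) : ClaimRun T x₀ S (22 / σ) β G (RadInv σ s₀) s₀ := by
  have hσ2 : σ ^ 2 ≤ σ := by nlinarith
  have hβ1 : β ≤ 1 := by linarith
  intro Pv hPv
  refine ⟨x₀ - Pv.v, x₀_sub_v_ne_zero hx₀ Pv, ?_, fun s hs hinv => ?_⟩
  · rw [sub_self, norm_zero]
    exact mul_nonneg (hG0 _) (by positivity)
  · set K : ℝ := 22 / σ + 1 with hK
    have hK0 : 0 ≤ K := by positivity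
    have hR0 : RadInv σ s₀ s₀ := by
      show |s₀.ε ^ 2 - s₀.ε ^ 2| ≤ (22 / σ + 1) * (s₀.etheta - s₀.etheta)
      rw [sub_self, abs_zero, sub_self, mul_zero]
    have hRs : |s.ε ^ 2 - s₀.ε ^ 2| ≤ K * (s₀.etheta - s.etheta) := hs.inv hR0
    have he0 : 0 ≤ s.etheta := s.etheta_nonneg hx₀ hS
    rcases he0.eq_or_lt with he | he
    · refine ⟨s, hs.inv hR0, ?_, ?_, ?_⟩
      · rw [← he]; simp
      · rw [sub_self, inner_zero_right]
      · rw [sub_self, inner_zero_right, map_zero, abs_zero, ← he]; simp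
    · have hβe : K * β * s.etheta ≤ K * s.etheta := by
        have h1 : β * s.etheta ≤ s.etheta := mul_le_of_le_one_left he0 hβ1
        have h2 := mul_le_mul_of_nonneg_left h1 hK0
        linarith [h2]
      have hab := abs_le.1 hRs
      have hlo : (0.09 : ℝ) + (22 / σ + 1) * β * s.etheta ≤ s.ε ^ 2 := by
        rw [← hK]; linarith [hab.1, hstart.1]
      have hhi : s.ε ^ 2 + (22 / σ + 1) * β * s.etheta ≤ 0.49 := by
        rw [← hK]; linarith [hab.2, hstart.2]
      obtain ⟨s', h1, h2, h3, h4, -⟩ := exists_state_stepκ hιs hι1 hιS hx₀ s he hσ hσ1 hβ0 hβ (x₀ - Pv.v)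
        (h Pv s hPv hs hinv he) hlo hhi
      refine ⟨s', ?_, h1.le, h2, ?_⟩
      · show |s'.ε ^ 2 - s₀.ε ^ 2| ≤ (22 / σ + 1) * (s₀.etheta - s'.etheta)
        rw [← hK] at h4 ⊢
        calc |s'.ε ^ 2 - s₀.ε ^ 2| ≤ |s'.ε ^ 2 - s.ε ^ 2| + |s.ε ^ 2 - s₀.ε ^ 2| := abs_sub_le _ _ _
          _ ≤ K * β * s.etheta + K * (s₀.etheta - s.etheta) := add_le_add h4 hRs
          _ = K * (s₀.etheta - s'.etheta) := by rw [h1]; ring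
      · rw [RCLike.re_to_complex]
        exact h3

/-- **Run-level intrinsic independence ⟹ a non-trivial closed invariant subspace** (`β := σ²/1000`).
[cite: Enflo2023, v2 (34)–(47), p.16–20; p.22 (11)] -/
theorem nis_of_indepRunκ [CompleteSpace P] (T : H →L[ℂ] H) (x₀ : H) (hx₀ : ‖x₀‖ = 1) (S : E →L[ℂ] E)
    (hS : ‖S‖ ≤ 1) {ι : P →+ (E →L[ℂ] E)} (hιs : ∀ (t : ℝ) (p : P), ι (t • p) = (t : ℂ) • ι p)
    (hι1 : ∀ p, ‖ι p‖ ≤ ‖p‖) (hιS : ∀ p, ι p ∘L S = S ∘L ι p) {σ : ℝ} (hσ : 0 < σ) (hσ1 : σ ≤ 1)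
    (s₀ : State T x₀ S)
    (hstart : (0.09 : ℝ) + (22 / σ + 1) * s₀.etheta ≤ s₀.ε ^ 2 ∧
      s₀.ε ^ 2 + (22 / σ + 1) * s₀.etheta ≤ 0.49)
    (h : IndepRunκ T x₀ S ι σ (σ ^ 2 / 1000) s₀) :
    HasNontrivialClosedInvariantSubspace T := by
  have hβ : 0 < σ ^ 2 / 1000 := by positivity
  have hσ2 : σ ^ 2 ≤ 1 := pow_le_one₀ hσ.le hσ1
  have hβ1 : σ ^ 2 / 1000 ≤ 1 := by linarith
  have hC : (0 : ℝ) ≤ 22 / σ := by positivity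
  exact nis_of_claimRun T x₀ hx₀ S hS hC hβ hβ1 (fun _ => 0) (fun _ => le_rfl)
    (fun η hη => ⟨1, one_pos, fun _ _ _ => hη.le⟩) s₀
    (claimRun_of_indepRunκ hx₀ hS hιs hι1 hιS hσ hσ1 hβ.le le_rfl (fun _ => 0) (fun _ => le_rfl) s₀ hstart h)

/-- **THE PACKAGED RESIDUAL OF PART B IN THE FORM THIS ROUTE NOW REACHES (intrinsic form)** — a HYPOTHESIS, never a
theorem: for every operator of the reduced class (`‖T‖ = 10⁻²⁰`, `H` separable infinite-dimensional) EITHER a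
non-trivial closed invariant subspace is at hand, OR there are a unit vector `x₀`, a true MC state `s₀` over the
shift of `ℓ²` whose radius has the margin `(22/σ + 1)(εθ)₀`, and a constant `0 < σ ≤ 1` such that the two-fold
first-order independence (34), EACH FUNCTIONAL AT ITS OWN SCALE, holds with modulus `σ` along the run from `s₀` over
the commutant of the shift (`IndepRunκ`).  This is (34) + "we can assume that for all `n` … `δ₂`-linearly
independent" (v2 p.16, p.19–20) and nothing else of pp.16–20. [cite: Enflo2023, v2 (34) p.16, p.19–20; §Theorem p.20–22] -/
@[claim "Enflo2023" "disputed"]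
def PartBResidualIndepκ : Prop :=
  ∀ (H : Type) [NormedAddCommGroup H] [InnerProductSpace ℂ H] [CompleteSpace H]
    [TopologicalSpace.SeparableSpace H], ¬ FiniteDimensional ℂ H →
    ∀ (T : H →L[ℂ] H), ‖T‖ < 1 → ‖T‖ = 1e-20 →
      HasNontrivialClosedInvariantSubspace T ∨
      ∃ (x₀ : H) (s₀ : State T x₀ Vy.S) (σ : ℝ), ‖x₀‖ = 1 ∧ 0 < σ ∧ σ ≤ 1 ∧
        ((0.09 : ℝ) + (22 / σ + 1) * s₀.etheta ≤ s₀.ε ^ 2 ∧ s₀.ε ^ 2 + (22 / σ + 1) * s₀.etheta ≤ 0.49) ∧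
        IndepRunκ T x₀ Vy.S (ιS Vy.S) σ (σ ^ 2 / 1000) s₀

/-- **The implication that IS a theorem (intrinsic form)**: `PartBResidualIndepκ → ISP_separable`.
[cite: Enflo2023, v2 §Theorem p.20–22; (34) p.16] -/
theorem isp_of_partBResidualIndepκ (hR : PartBResidualIndepκ) : Referee.ISP_separable := by
  intro H _ _ _ _ hH T
  by_cases hT0 : T = 0
  · rw [hT0]; exact EndToEnd.nis_zero hH
  · obtain ⟨hnorm, hiff⟩ := wlog_opNorm T hT0
    set T' : H →L[ℂ] H := (((1e-20 : ℝ) / ‖T‖ : ℝ) : ℂ) • T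
    have hT1 : ‖T'‖ < 1 := by rw [hnorm]; norm_num
    rcases hR H hH T' hT1 hnorm with hinv | ⟨x₀, s₀, σ, hx₀, hσ, hσ1, hstart, hrun⟩
    · exact hiff.1 hinv
    · obtain ⟨hιs, hι1, hιS⟩ := ιS_props (Vy.S)
      exact hiff.1 (nis_of_indepRunκ T' x₀ hx₀ Vy.S Vy.norm_S_le hιs hι1 hιS hσ hσ1 s₀ hstart hrun)

/-- The gen-11 packaged residual implies the intrinsic one (pointwise in the witness). [folklore] -/
theorem partBResidualIndepκ_of_indep₂ (hR : PartBResidualIndep₂) : PartBResidualIndepκ := by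
  intro H _ _ _ _ hH T hT1 hnorm
  rcases hR H hH T hT1 hnorm with hinv | ⟨x₀, s₀, σ, hx₀, hσ, hσ1, hstart, hrun⟩
  · exact Or.inl hinv
  · exact Or.inr ⟨x₀, s₀, σ, hx₀, hσ, hσ1, hstart, indepRunκ_of_indepRun₂ hσ hrun⟩

end RunLevelScale

end StepRealisation

end Literature.Analysis.OperatorTheory.Enflo2023

end
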